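import Mathlib
import Literature.Geometry.DiscreteGeometry.TwoShellPatterns

/-!
# Two-shell-good regions are relatively dense
(route `HullMinimality`, crux `LayeredWindows` = stmt-AtomisticToContinuum-11778, line `registered`,
stub S5 `stub_goodRegionDense`)

If every particle within `ρ` of `x i` is two-shell good (`IsTwoShellGood (1/20) (47/50) 1`), then
every point `y` with `dist y (x i) + r₀ ≤ ρ / 2` has a particle within `r₀`, where
`r₀ = 1 + 1 / (2 c₀ - 1/10)` depends only on a covering constant `c₀ > 1/10` of the unit
(first-shell) vectors of the two patterns: for every `u` some unit pattern vector `v` has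
`⟪v, u⟫ ≥ c₀ ‖u‖`.

PROOF (nearest-particle descent). Let `p` minimise `dist (x p) y` and put `r := dist (x p) y`. If
`r < r₀` we are done. Otherwise `r ≥ r₀ ≥ 1` and `dist (x p) (x i) ≤ r + dist y (x i) ≤ ρ`, so `p`
is good at some scale `a ∈ [47/50, 1]` with isometry `A`, pattern `P` and assignment `f`. A linear
isometry of `ℝ³` is onto, so `y - x p = A u'` with `‖u'‖ = r`; the covering hypothesis gives a
unit vector `v ∈ P` with `⟪A v, y - x p⟫ = ⟪v, u'⟫ ≥ c₀ r`. Then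
`‖x p + a • A v - y‖² = a² - 2 a ⟪A v, y - x p⟫ + r² ≤ a² - 2 a c₀ r + r² < (r - a/20)²`
(the last because `a · 399/400 < 1 < r (2 c₀ - 1/10)`), so the particle `x (f v)`, which is within
`a/20` of `x p + a • A v`, is strictly closer to `y` than `x p` — a contradiction.
-/

noncomputable section

open scoped BigOperators Classical InnerProductSpace

namespace Summit.AtomisticToContinuum.Crystallization.Theorems.LayeredWindowsLocal

open Literature.Geometry.DiscreteGeometry

local notation "E3" => EuclideanSpace ℝ (Fin 3)

/-- The scalar inequality of the descent step: with `k = 2 c₀ - 1/10 > 0`, `a ∈ [47/50, 1]`,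
`r ≥ 1 + 1/k` and `d² ≤ a² - 2 a c₀ r + r²`, one has `d < r - a/20` (because
`a² - 2 a c₀ r + r² < (r - a/20)²` amounts to `a · 399/400 < r k`, and `r k ≥ k + 1 > 1`, while
`r - a/20 ≥ 0`). -/
theorem goodRegionDense_descent_ineq {c₀ a r d : ℝ} (hc₀ : 1 / 10 < c₀) (ha1 : 47 / 50 ≤ a)
    (ha2 : a ≤ 1) (hr : 1 + 1 / (2 * c₀ - 1 / 10) ≤ r)
    (hd2 : d ^ 2 ≤ a ^ 2 - 2 * a * c₀ * r + r ^ 2) : d < r - a / 20 := by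
  have hk : 0 < 2 * c₀ - 1 / 10 := by linarith
  have h1 : (1 + 1 / (2 * c₀ - 1 / 10)) * (2 * c₀ - 1 / 10) = (2 * c₀ - 1 / 10) + 1 := by
    rw [add_mul, one_mul, one_div_mul_cancel hk.ne']
  have h2 : (1 + 1 / (2 * c₀ - 1 / 10)) * (2 * c₀ - 1 / 10) ≤ r * (2 * c₀ - 1 / 10) :=
    mul_le_mul_of_nonneg_right hr hk.le
  have hrk : 1 < r * (2 * c₀ - 1 / 10) := by linarith
  have ha0 : 0 < a := by linarith
  have h3 : a * (399 / 400) < r * (2 * c₀ - 1 / 10) := by linarith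
  have h4 : a * (a * (399 / 400)) < a * (r * (2 * c₀ - 1 / 10)) := mul_lt_mul_of_pos_left h3 ha0
  have h5 : d ^ 2 < (r - a / 20) ^ 2 := by nlinarith
  have h6 : 0 ≤ r - a / 20 := by
    have : 0 < 1 / (2 * c₀ - 1 / 10) := one_div_pos.2 hk
    linarith
  exact lt_of_pow_lt_pow_left₀ 2 h6 h5

/-- Expansion of `‖a • w - z‖²` for a unit vector `w` of a real inner product space:
`‖a • w - z‖² = a² - 2 a ⟪w, z⟫ + ‖z‖²`. -/
theorem goodRegionDense_norm_sq_expand (w z : E3) (a : ℝ) (hw : ‖w‖ = 1) :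
    ‖a • w - z‖ ^ 2 = a ^ 2 - 2 * a * ⟪w, z⟫_ℝ + ‖z‖ ^ 2 := by
  rw [norm_sub_sq_real, norm_smul, hw, mul_one, real_inner_smul_left, Real.norm_eq_abs, sq_abs]
  ring

/-- A linear isometry of `ℝ³` is onto (finite dimension): every vector is of the form `A u`. -/
theorem goodRegionDense_isometry_surjective (A : E3 →ₗᵢ[ℝ] E3) (w : E3) : ∃ u : E3, A u = w := by
  refine ⟨(A.toLinearIsometryEquiv rfl).symm w, ?_⟩
  rw [← LinearIsometry.toLinearIsometryEquiv_apply A rfl, LinearIsometryEquiv.apply_symm_apply]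

/-- **Stub S5 `stub_goodRegionDense` (two-shell-good regions are relatively dense).** Given a
covering constant `c₀ > 1/10` of the unit vectors of both two-shell patterns, there is `r₀ ≥ 1`
such that: if every particle within `ρ` of `x i` is two-shell good, then every point `y` with
`dist y (x i) + r₀ ≤ ρ / 2` has a particle within `r₀` (the particle nearest to `y`, if at distance
`r ≥ r₀`, is good, and its neighbour along a pattern direction making cosine `≥ c₀` with `y - x p`
is strictly closer to `y`). -/
theorem stub_goodRegionDense :
    ∀ c₀ : ℝ, 1 / 10 < c₀ → (∀ P : Finset E3, (P = fccTwoShellPattern ∨ P = hcpTwoShellPattern) → ∀ u : E3, ∃ v ∈ P, ‖v‖ = 1 ∧ c₀ * ‖u‖ ≤ ⟪v, u⟫_ℝ) → ∃ r₀ : ℝ, 1 ≤ r₀ ∧ ∀ (N : ℕ) (x : Fin N → E3) (i : Fin N) (ρ : ℝ), (∀ j : Fin N, dist (x j) (x i) ≤ ρ → IsTwoShellGood (1 / 20) (47 / 50) 1 x j) → ∀ y : E3, dist y (x i) + r₀ ≤ ρ / 2 → ∃ j : Fin N, dist (x j) y < r₀ := by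
  intro c₀ hc₀ hcov
  have hk : 0 < 2 * c₀ - 1 / 10 := by linarith
  have hk1 : 0 < 1 / (2 * c₀ - 1 / 10) := one_div_pos.2 hk
  refine ⟨1 + 1 / (2 * c₀ - 1 / 10), by linarith, ?_⟩
  intro N x i ρ hgood y hy
  -- the particle nearest to `y`
  obtain ⟨p, -, hpmin⟩ :=
    Finset.exists_min_image Finset.univ (fun j => dist (x j) y) ⟨i, Finset.mem_univ i⟩
  refine ⟨p, ?_⟩
  by_contra hfar
  rw [not_lt] at hfar
  -- `x p` is no farther from `y` than `x i`, hence within `ρ` of `x i`: it is good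
  have hpy : dist (x p) y ≤ dist y (x i) := by
    rw [dist_comm y (x i)]
    exact hpmin i (Finset.mem_univ i)
  have hpi : dist (x p) (x i) ≤ ρ :=
    calc dist (x p) (x i) ≤ dist (x p) y + dist y (x i) := dist_triangle _ _ _
      _ ≤ ρ := by linarith
  obtain ⟨a, ha1, ha2, A, P, f, hP, hf, -, -⟩ := hgood p hpi
  -- pull `y - x p` back through the (onto) isometry `A` and cover it by a unit pattern vector
  obtain ⟨u', hu'⟩ := goodRegionDense_isometry_surjective A (y - x p)
  obtain ⟨v, hvP, hv1, hvu⟩ := hcov P hP u'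
  have hyr : ‖y - x p‖ = dist (x p) y := by rw [← dist_eq_norm, dist_comm]
  have hnu' : ‖u'‖ = dist (x p) y := by rw [← A.norm_map u', hu', hyr]
  have hinner : ⟪A v, y - x p⟫_ℝ = ⟪v, u'⟫_ℝ := by rw [← hu', A.inner_map_map]
  have hAv : ‖A v‖ = 1 := by rw [A.norm_map, hv1]
  have ha0 : 0 ≤ a := by linarith
  -- the ideal site `x p + a • A v` is at squared distance `≤ a² - 2 a c₀ r + r²` from `y`
  have hd2 : dist (x p + a • A v) y ^ 2 ≤
      a ^ 2 - 2 * a * c₀ * dist (x p) y + dist (x p) y ^ 2 := by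
    have h1 : dist (x p + a • A v) y = ‖a • A v - (y - x p)‖ := by
      rw [dist_eq_norm]
      congr 1
      abel
    rw [h1, goodRegionDense_norm_sq_expand (A v) (y - x p) a hAv, hinner, hyr]
    rw [hnu'] at hvu
    have h2 : a * (c₀ * dist (x p) y) ≤ a * ⟪v, u'⟫_ℝ := mul_le_mul_of_nonneg_left hvu ha0
    linarith
  -- hence at distance `< r - a/20`, and the matched particle `x (f v)` beats `x p`
  have hdesc : dist (x p + a • A v) y < dist (x p) y - a / 20 :=
    goodRegionDense_descent_ineq hc₀ ha1 ha2 hfar hd2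
  obtain ⟨-, hq⟩ := hf v hvP
  have hlt : dist (x (f v)) y < dist (x p) y :=
    calc dist (x (f v)) y ≤ dist (x (f v)) (x p + a • A v) + dist (x p + a • A v) y :=
          dist_triangle _ _ _
      _ < 1 / 20 * a + (dist (x p) y - a / 20) := add_lt_add_of_le_of_lt hq hdesc
      _ = dist (x p) y := by ring
  exact absurd (hpmin (f v) (Finset.mem_univ _)) (not_le.2 hlt)

end Summit.AtomisticToContinuum.Crystallization.Theorems.LayeredWindowsLocal

end
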